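import Mathlib
import Summits.KontsevichZagierPeriods.Zeta5Search.Elimination.DictBridge
import Summits.KontsevichZagierPeriods.Zeta5Search.Elimination.DictBridgeFace
import HarnessLib

/-!
# The strata of the boundary of gen-1's `DictBridge` (E-L20b; fam-elim gen 24)

HONEST FRAMING: systematic search; no irrationality claim unless certified — identities among rational Taylor data and
gen-1's dictionary values only; nothing about sizes or irrationality.

OUR work (Summit side; `families/elim/FAMILY.md` §17).  The residual node `DictBridgeBoundary` of
`Elimination/DictBridge.lean` (gen-1's four-term relation `DictBridge` at the bridge clusters `{c, c+e₇, Hc, DSc}` of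
level `c₀ ≤ 1` or with a non-edge pair sum `> c₀`) splits into exactly two strata:
* `DictBridgeLevelOne` (node, OPEN, stated here): level `c₀ ≤ 1` — by the four `RegionHyp`s these are exactly THREE
  clusters, `c ∈ {(1;0,0,0,0,0,0,0), (1;0,1,0,0,0,0,0), (1;1,0,0,0,0,0,0)}` i.e.
  `a ∈ {(1,0,1,0,1,1,1,1), (0,1,0,0,1,1,1,1), (0,0,1,0,1,1,1,1)}` — nine explicit rational identities, all verified
  EXACTLY outside Lean (`HOME/pub-zeta5-fam-elim/g24/bd/level_sweep.py`), no Lean evaluation path attempted here;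
* the ghost face `{1,6}`: `nonEpair_is_16` — under the boxes of `c` (`2c_k ≤ c₀+1`), of `c+e₇` (`2(c₇+1) ≤ c₀+1`) and
  of `Hc` (`2(c_k+1) ≤ c₀+2`, `k = 4,5`) the only non-edge pair (`(1,6),(1,7),(2,7),(3,5),(4,5),(4,6)`) whose sum can
  exceed `c₀` is `(1,6)`; that stratum is `Elimination/DictBridgeFace.DictBridgeFace16`, PROVED there modulo the face
  recurrences `CasVWFace16`.
Hence `dictBridgeBoundary_of : DictBridgeFace16 → DictBridgeLevelOne → DictBridgeBoundary` and
`dictBridge_of_strata : CasVWFace16 → DictBridgeLevelOne → DictBridge` (gen-1's GLOBAL node from one face closed form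
and three level-`1` clusters).  EXACT evidence: `DictBridge` holds at all 6628 bridge clusters of levels `1…5`.
What this is NOT: neither `CasVWFace16` nor `DictBridgeLevelOne` is proved; the class verdict is unchanged
(T1 NO / T2 NO / T4 YES).
-/

open Finset

namespace Summit.KontsevichZagierPeriods.Zeta5Search.Elimination

open Summit.KontsevichZagierPeriods.Zeta5Search.WedgeDictionary
open Literature.NumberTheory.Irrationality.BrownZudilin2022 (bOfA)

/-- **gen-1's `DictBridge` at level `c₀ ≤ 1` (node; OPEN — three explicit clusters).**  Under the four `RegionHyp`s,
`c₀ ≤ 1` leaves exactly the clusters with base `c = (1;0⁷)`, `(1;0,1,0,0,0,0,0)`, `(1;1,0,0,0,0,0,0)`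
(`a = (1,0,1,0,1,1,1,1), (0,1,0,0,1,1,1,1), (0,0,1,0,1,1,1,1)`); gen-1's relation there is nine rational identities
(three rows × three clusters; the admissible `j`'s give the same values), verified EXACTLY outside Lean by fam-elim g24
(`level_sweep.py`); NOT proved here (no in-Lean evaluation path for `Q, P̂, P` at a point is set up in this family). -/
@[conjecture] def DictBridgeLevelOne : Prop :=
  ∀ (a : Fin 8 → ℤ) (j₀ j₁ j₂ j₃ : ℕ), bOfA a 0 ≤ 1 →
    RegionHyp a j₀ → RegionHyp (a - slotDown 7) j₁ → RegionHyp (a + halfUp457) j₂ → RegionHyp (a + dsUp) j₃ →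
      DictFourTerm (bridgeBase (bOfA a)) (bridgeSlot (bOfA a)) (bridgeHalf (bOfA a)) (bridgeApex (bOfA a))
        a (a - slotDown 7) (a + halfUp457) (a + dsUp) j₀ j₁ j₂ j₃

/-- **Classification of the pair-sum boundary.**  If the base `c`, the point `c+e₇` and the point `Hc` of a bridge
cluster satisfy their `RegionHyp`s and some non-edge pair sum exceeds the level, then `c₁ + c₆ > c₀` (the pairs with a
`7` are excluded by the box of `c+e₇`, those with a `4` or `5` by the box of `Hc`). -/
theorem nonEpair_is_16 (a : Fin 8 → ℤ) {j₀ j₁ j₂ : ℕ} (H₀ : RegionHyp a j₀) (H₁ : RegionHyp (a - slotDown 7) j₁)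
    (H₂ : RegionHyp (a + halfUp457) j₂) {jk : ℕ × ℕ} (hjk : jk ∈ nonEpairs)
    (hlt : bOfA a 0 < bOfA a jk.1 + bOfA a jk.2) : bOfA a 0 < bOfA a 1 + bOfA a 6 := by
  obtain ⟨-, -, hreg, -, -⟩ := H₀
  obtain ⟨-, -, hreg1, -, -⟩ := H₁
  obtain ⟨-, -, hreg2, -, -⟩ := H₂
  have q1 := (hreg 1 (mem_Icc.2 ⟨by norm_num, by norm_num⟩)).2
  have q2 := (hreg 2 (mem_Icc.2 ⟨by norm_num, by norm_num⟩)).2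
  have q3 := (hreg 3 (mem_Icc.2 ⟨by norm_num, by norm_num⟩)).2
  have q6 := (hreg 6 (mem_Icc.2 ⟨by norm_num, by norm_num⟩)).2
  have q7 := (hreg1 7 (mem_Icc.2 ⟨by norm_num, by norm_num⟩)).2
  rw [bOfA_sub_slotDown7 a 7 (by norm_num), bOfA_sub_slotDown7 a 0 (by norm_num), if_pos rfl,
    if_neg (show (0 : ℕ) ≠ 7 by decide)] at q7
  have q4 := (hreg2 4 (mem_Icc.2 ⟨by norm_num, by norm_num⟩)).2
  have q5 := (hreg2 5 (mem_Icc.2 ⟨by norm_num, by norm_num⟩)).2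
  rw [bOfA_add_halfUp457 a 4 (by norm_num), bOfA_add_halfUp457 a 0 (by norm_num), if_pos (by decide),
    if_pos (by decide)] at q4
  rw [bOfA_add_halfUp457 a 5 (by norm_num), bOfA_add_halfUp457 a 0 (by norm_num), if_pos (by decide),
    if_pos (by decide)] at q5
  simp only [nonEpairs, List.mem_cons, List.mem_nil_iff, or_false] at hjk
  rcases hjk with rfl | rfl | rfl | rfl | rfl | rfl <;> simp only at hlt <;> omega

/-- **The residual node of `Elimination/DictBridge` from its two strata** (a CONDITIONAL edge: modulo the open nodes
`DictBridgeFace16` — itself reduced to `CasVWFace16` in `Elimination/DictBridgeFace` — and `DictBridgeLevelOne`). -/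
theorem dictBridgeBoundary_of (hF : DictBridgeFace16) (hL : DictBridgeLevelOne) : DictBridgeBoundary := by
  unfold DictBridgeBoundary
  intro a j₀ j₁ j₂ j₃ hbd H₀ H₁ H₂ H₃
  rcases hbd with h1 | ⟨jk, hjk, hlt⟩
  · exact hL a j₀ j₁ j₂ j₃ h1 H₀ H₁ H₂ H₃
  · exact hF a j₀ j₁ j₂ j₃ (nonEpair_is_16 a H₀ H₁ H₂ hjk hlt) H₀ H₁ H₂ H₃

/-- **gen-1's GLOBAL node `DictBridge` from the face recurrences of `V∧W` and the three level-`1` clusters**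
(CONDITIONAL edge; the interior is `dictBridge_at`, the face is `dictBridgeFace16_of`). -/
theorem dictBridge_of_strata (hX : CasVWFace16) (hL : DictBridgeLevelOne) : DictBridge :=
  dictBridge_of_boundary (dictBridgeBoundary_of (dictBridgeFace16_of hX) hL)

end Summit.KontsevichZagierPeriods.Zeta5Search.Elimination
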